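/- Width seat `ym-line-cbag-p1-w2` (prover-ym-line-cbag-p1-w2-g14-0) on the planner-of-record's LINE 5, route `HankelDensitySplitting`:
helper for REGISTERED STUB B `stub_freeKernelMargin` of the birth skeleton v2 of crux `LogWindowMixedDominance` (stmt-QuantumFields-26617).
Pure lattice-Maxwell analysis; RECORD-type material (node `LatticeNonFreezing`); the Yang–Mills mass gap is NOT proved by anything here,
and the crux stays open. -/
import Summits.QuantumFields.YangMills.Theorems.LogWindowMixedDominanceGreenDecay
import Literature.MathematicalPhysics.QuantumFieldTheory.CurvatureGaussianField
import Literature.Probability.LatticeModels.LatticeGreenPotential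
import HarnessLib

/-!
# Decay of the lattice-Maxwell plaquette kernel between a spatial plaquette and a distant one

Support file for crux `LogWindowMixedDominance` (stmt-QuantumFields-26617), stub B `FreeKernelMargin`.  For the free curvature kernel
`K(p, q) = curvatureTwoPoint (d := 4) p q` (Garban–Sepúlveda's gradient spin-wave on 2-forms; `LogWindow.kFree m i j k l` for `p = (0; i,j)`,
`q = (m e₀; k,l)` is this kernel):

* `KernelDecay.curvatureTwoPoint_eq_groups` — the **double-curl expansion**: with `T(a,c) = G(x−y) − G(x−(y+e_c)) − G(x+e_a−y) + G(x+e_a−(y+e_c))`,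
  `G = latticeGreen`, `K((x;i,j),(y;k,l)) = ([i=k]T(j,l) − [i=l]T(j,k) − [j=k]T(i,l) + [j=l]T(i,k))/2` — each group a mixed second
  difference of the lattice Green function (sixteen-term expansion of `curvatureTwoPoint`, as the tree's
  `AxialKernel.curvatureTwoPoint_inPlane_eq_sixteen` for the axial pair);
* `KernelDecay.abs_group_le`, `abs_group_diff_le` — for a SPATIAL direction `a` and any `c`, at `x = 0`, `y = m e₀`:
  `|T(a,c)| ≤ C₄/m⁴` (`m ≥ 1`) and `|T(a,c)[n+1] − T(a,c)[n]| ≤ C₅/n⁵` (`n ≥ 1`), from the four patterns of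
  `LogWindowMixedDominanceGreenDecay` (evenness of `G` moves the evaluation points to positive times);
* `KernelDecay.abs_kernel_le`, `abs_kernel_succ_sub_le` — hence `|K((0;i,j),(m e₀;k,l))| ≤ 2C₄/m⁴` and
  `|K((0;i,j),((n+1) e₀;k,l)) − K((0;i,j),(n e₀;k,l))| ≤ 2C₅/n⁵` for spatial planes `0 < i < j` and all `k < l` (route-independent: no
  `Theses` import; the crux's `kFree` is this kernel with `m e₀ = m • e₀`).

Only orders of magnitude (`K ~ m⁻⁴`, `∂ₘK ~ m⁻⁵`, the dipole–dipole law of `d = 4` lattice Maxwell theory) are proved.  [folklore]; no rung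
or summit statement is proved here.
-/

set_option autoImplicit false

noncomputable section

namespace Summit.QuantumFields.YangMills.Theorems.HankelDensitySplitting.LogWindow

namespace KernelDecay

open Real MeasureTheory Set Literature.Probability.LatticeModels
open Literature.MathematicalPhysics.QuantumFieldTheory Literature.MathematicalPhysics.QuantumLattice

/-! ### The double-curl expansion -/

/-- **Double-curl expansion of the lattice-Maxwell plaquette kernel.**  For plaquettes `p = (x; i<j)`, `q = (y; k<l)` of `ℤ⁴`:
`curvatureTwoPoint p q = ([i=k]·T(j,l) − [i=l]·T(j,k) − [j=k]·T(i,l) + [j=l]·T(i,k))/2` with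
`T(a,c) = G(x−y) − G(x−(y+e_c)) − G(x+e_a−y) + G(x+e_a−(y+e_c))`, `G = latticeGreen` (only equal-direction boundary edges pair;
`edgeGreen = [dir = dir']·G/2`). [folklore] -/
theorem curvatureTwoPoint_eq_groups (x y : Site 4) (i j k l : Fin 4) (hij : i < j) (hkl : k < l) :
    curvatureTwoPoint (d := 4) ((x, ⟨(i, j), hij⟩) : ZdPlaquette 4) ((y, ⟨(k, l), hkl⟩) : ZdPlaquette 4) =
      ((if i = k then latticeGreen (x - y) - latticeGreen (x - (y + Pi.single l 1)) - latticeGreen (x + Pi.single j 1 - y)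
          + latticeGreen (x + Pi.single j 1 - (y + Pi.single l 1)) else 0)
        - (if i = l then latticeGreen (x - y) - latticeGreen (x - (y + Pi.single k 1)) - latticeGreen (x + Pi.single j 1 - y)
          + latticeGreen (x + Pi.single j 1 - (y + Pi.single k 1)) else 0)
        - (if j = k then latticeGreen (x - y) - latticeGreen (x - (y + Pi.single l 1)) - latticeGreen (x + Pi.single i 1 - y)
          + latticeGreen (x + Pi.single i 1 - (y + Pi.single l 1)) else 0)
        + (if j = l then latticeGreen (x - y) - latticeGreen (x - (y + Pi.single k 1)) - latticeGreen (x + Pi.single i 1 - y)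
          + latticeGreen (x + Pi.single i 1 - (y + Pi.single k 1)) else 0)) / 2 := by
  simp only [curvatureTwoPoint, Fin.sum_univ_four, plaquetteBoundary, plaquetteBoundarySign, edgeGreen,
    Matrix.cons_val_zero, Matrix.cons_val_one, Matrix.cons_val]
  split_ifs <;> ring

/-! ### Site bookkeeping: from `m e₀ ± e_a ± e_c` to `(n, x)` coordinates -/

section Sites

variable (m : ℕ) (a c : Fin 3)

/-- `m e₀ − 0 = (m, 0)`. -/
theorem axis_sub_zero : (((m : ℤ) • Pi.single (0 : Fin 4) (1 : ℤ) : Site 4) - 0) = Fin.cons (m : ℤ) 0 := by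
  ext q
  refine Fin.cases ?_ (fun q' => ?_) q
  · simp
  · simp

/-- `m e₀ + e_{c+1} − 0 = (m, e_c)`. -/
theorem axis_add_succ_sub_zero :
    (((m : ℤ) • Pi.single (0 : Fin 4) (1 : ℤ) : Site 4) + Pi.single (Fin.succ c) 1 - 0) = Fin.cons (m : ℤ) (Pi.single c 1) := by
  ext q
  refine Fin.cases ?_ (fun q' => ?_) q
  · simp
  · simp [Pi.single_apply, Fin.succ_inj]

/-- `m e₀ + e₀ − 0 = (m+1, 0)`. -/
theorem axis_add_zero_sub_zero :
    (((m : ℤ) • Pi.single (0 : Fin 4) (1 : ℤ) : Site 4) + Pi.single 0 1 - 0) = Fin.cons ((m + 1 : ℕ) : ℤ) 0 := by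
  ext q
  refine Fin.cases ?_ (fun q' => ?_) q
  · simp
  · simp

/-- `m e₀ − (0 + e_{a+1}) = (m, −e_a)`. -/
theorem axis_sub_succ :
    (((m : ℤ) • Pi.single (0 : Fin 4) (1 : ℤ) : Site 4) - (0 + Pi.single (Fin.succ a) 1)) = Fin.cons (m : ℤ) (-Pi.single a 1) := by
  ext q
  refine Fin.cases ?_ (fun q' => ?_) q
  · simp
  · simp [Pi.single_apply, Fin.succ_inj]

/-- `m e₀ + e_{c+1} − (0 + e_{a+1}) = (m, −e_a + e_c)`. -/
theorem axis_add_succ_sub_succ :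
    (((m : ℤ) • Pi.single (0 : Fin 4) (1 : ℤ) : Site 4) + Pi.single (Fin.succ c) 1 - (0 + Pi.single (Fin.succ a) 1)) =
      Fin.cons (m : ℤ) (-Pi.single a 1 + Pi.single c 1) := by
  ext q
  refine Fin.cases ?_ (fun q' => ?_) q
  · simp
  · simp [Pi.single_apply, Fin.succ_inj]
    split_ifs <;> simp_all

/-- `m e₀ + e₀ − (0 + e_{a+1}) = (m+1, −e_a)`. -/
theorem axis_add_zero_sub_succ :
    (((m : ℤ) • Pi.single (0 : Fin 4) (1 : ℤ) : Site 4) + Pi.single 0 1 - (0 + Pi.single (Fin.succ a) 1)) =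
      Fin.cons ((m + 1 : ℕ) : ℤ) (-Pi.single a 1) := by
  ext q
  refine Fin.cases ?_ (fun q' => ?_) q
  · simp
  · simp [Pi.single_apply, Fin.succ_inj]

end Sites

/-! ### Bounds for one group -/

/-- The group `T(a,c)` at `x = 0`, `y = m e₀`, rewritten at positive times: for spatial `a = a'+1` and spatial `c = c'+1` it is MINUS the
`ss` pattern `Δ_{a'}Δ_{c'} G(m, −e_{a'})`. -/
theorem group_eq_ss (m : ℕ) (a' c' : Fin 3) :
    latticeGreen ((0 : Site 4) - ((m : ℤ) • Pi.single (0 : Fin 4) (1 : ℤ)))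
      - latticeGreen ((0 : Site 4) - (((m : ℤ) • Pi.single (0 : Fin 4) (1 : ℤ)) + Pi.single (Fin.succ c') 1))
      - latticeGreen ((0 : Site 4) + Pi.single (Fin.succ a') 1 - ((m : ℤ) • Pi.single (0 : Fin 4) (1 : ℤ)))
      + latticeGreen ((0 : Site 4) + Pi.single (Fin.succ a') 1 - (((m : ℤ) • Pi.single (0 : Fin 4) (1 : ℤ)) + Pi.single (Fin.succ c') 1)) =
    -(latticeGreen (Fin.cons (m : ℤ) (-Pi.single a' 1 + Pi.single a' 1 + Pi.single c' 1) : Site 4)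
        - latticeGreen (Fin.cons (m : ℤ) (-Pi.single a' 1 + Pi.single a' 1) : Site 4)
        - latticeGreen (Fin.cons (m : ℤ) (-Pi.single a' 1 + Pi.single c' 1) : Site 4)
        + latticeGreen (Fin.cons (m : ℤ) (-Pi.single a' 1) : Site 4)) := by
  rw [Literature.Probability.LatticeModels.latticeGreen_sub_comm (0 : Site 4),
    Literature.Probability.LatticeModels.latticeGreen_sub_comm (0 : Site 4),
    Literature.Probability.LatticeModels.latticeGreen_sub_comm ((0 : Site 4) + _),
    Literature.Probability.LatticeModels.latticeGreen_sub_comm ((0 : Site 4) + _), axis_sub_zero, axis_add_succ_sub_zero, axis_sub_succ, axis_add_succ_sub_succ,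
    neg_add_cancel, zero_add]
  ring

/-- For spatial `a = a'+1` and `c = 0` the group is MINUS the `s0` pattern at base `(m, −e_{a'})`. -/
theorem group_eq_s0 (m : ℕ) (a' : Fin 3) :
    latticeGreen ((0 : Site 4) - ((m : ℤ) • Pi.single (0 : Fin 4) (1 : ℤ)))
      - latticeGreen ((0 : Site 4) - (((m : ℤ) • Pi.single (0 : Fin 4) (1 : ℤ)) + Pi.single 0 1))
      - latticeGreen ((0 : Site 4) + Pi.single (Fin.succ a') 1 - ((m : ℤ) • Pi.single (0 : Fin 4) (1 : ℤ)))
      + latticeGreen ((0 : Site 4) + Pi.single (Fin.succ a') 1 - (((m : ℤ) • Pi.single (0 : Fin 4) (1 : ℤ)) + Pi.single 0 1)) =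
    -(latticeGreen (Fin.cons ((m + 1 : ℕ) : ℤ) (-Pi.single a' 1 + Pi.single a' 1) : Site 4)
        - latticeGreen (Fin.cons (m : ℤ) (-Pi.single a' 1 + Pi.single a' 1) : Site 4)
        - latticeGreen (Fin.cons ((m + 1 : ℕ) : ℤ) (-Pi.single a' 1) : Site 4)
        + latticeGreen (Fin.cons (m : ℤ) (-Pi.single a' 1) : Site 4)) := by
  rw [Literature.Probability.LatticeModels.latticeGreen_sub_comm (0 : Site 4),
    Literature.Probability.LatticeModels.latticeGreen_sub_comm (0 : Site 4),
    Literature.Probability.LatticeModels.latticeGreen_sub_comm ((0 : Site 4) + _),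
    Literature.Probability.LatticeModels.latticeGreen_sub_comm ((0 : Site 4) + _), axis_sub_zero, axis_add_zero_sub_zero, axis_sub_succ, axis_add_zero_sub_succ,
    neg_add_cancel]
  ring

/-- **Group bound.**  For a spatial direction `a = a'+1`, any direction `c` and `m ≥ 1`:
`|T(a,c)| ≤ (π/2)·(2·12³/(2/(3π))⁴)/m⁴/(2π)³` at `x = 0`, `y = m e₀`. -/
theorem abs_group_le (a' : Fin 3) (c : Fin 4) {m : ℕ} (hm : 1 ≤ m) :
    |latticeGreen ((0 : Site 4) - ((m : ℤ) • Pi.single (0 : Fin 4) (1 : ℤ)))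
      - latticeGreen ((0 : Site 4) - (((m : ℤ) • Pi.single (0 : Fin 4) (1 : ℤ)) + Pi.single c 1))
      - latticeGreen ((0 : Site 4) + Pi.single (Fin.succ a') 1 - ((m : ℤ) • Pi.single (0 : Fin 4) (1 : ℤ)))
      + latticeGreen ((0 : Site 4) + Pi.single (Fin.succ a') 1 - (((m : ℤ) • Pi.single (0 : Fin 4) (1 : ℤ)) + Pi.single c 1))| ≤
      π / 2 * (2 * 12 ^ 3 / (2 / (3 * π)) ^ 4) / (m : ℝ) ^ 4 / (2 * π) ^ 3 := by
  induction c using Fin.cases with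
  | zero =>
    rw [group_eq_s0, abs_neg]
    refine (GreenDecay.abs_diff_s0_le a' hm (-Pi.single a' 1)).trans ?_
    have hπ : (1 : ℝ) ≤ π / 2 := by linarith [Real.pi_gt_three]
    have h0 : 0 ≤ (2 * 12 ^ 3 / (2 / (3 * π)) ^ 4) / (m : ℝ) ^ 4 / (2 * π) ^ 3 := by positivity
    calc 1 * (2 * 12 ^ 3 / (2 / (3 * π)) ^ 4) / (m : ℝ) ^ 4 / (2 * π) ^ 3
        = 1 * ((2 * 12 ^ 3 / (2 / (3 * π)) ^ 4) / (m : ℝ) ^ 4 / (2 * π) ^ 3) := by ring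
      _ ≤ π / 2 * ((2 * 12 ^ 3 / (2 / (3 * π)) ^ 4) / (m : ℝ) ^ 4 / (2 * π) ^ 3) := mul_le_mul_of_nonneg_right hπ h0
      _ = π / 2 * (2 * 12 ^ 3 / (2 / (3 * π)) ^ 4) / (m : ℝ) ^ 4 / (2 * π) ^ 3 := by ring
  | succ c' =>
    rw [group_eq_ss, abs_neg]
    exact GreenDecay.abs_diff_ss_le a' c' hm (-Pi.single a' 1)

/-- **Group difference bound.**  For a spatial direction `a = a'+1`, any direction `c` and `n ≥ 1`:
`|T(a,c)[n+1] − T(a,c)[n]| ≤ 7·(16·12³/(2/(3π))⁵)/n⁵/(2π)³`. -/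
theorem abs_group_diff_le (a' : Fin 3) (c : Fin 4) {n : ℕ} (hn : 1 ≤ n) :
    |(latticeGreen ((0 : Site 4) - (((n + 1 : ℕ) : ℤ) • Pi.single (0 : Fin 4) (1 : ℤ)))
      - latticeGreen ((0 : Site 4) - ((((n + 1 : ℕ) : ℤ) • Pi.single (0 : Fin 4) (1 : ℤ)) + Pi.single c 1))
      - latticeGreen ((0 : Site 4) + Pi.single (Fin.succ a') 1 - (((n + 1 : ℕ) : ℤ) • Pi.single (0 : Fin 4) (1 : ℤ)))
      + latticeGreen ((0 : Site 4) + Pi.single (Fin.succ a') 1 - ((((n + 1 : ℕ) : ℤ) • Pi.single (0 : Fin 4) (1 : ℤ)) + Pi.single c 1)))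
    - (latticeGreen ((0 : Site 4) - ((n : ℤ) • Pi.single (0 : Fin 4) (1 : ℤ)))
      - latticeGreen ((0 : Site 4) - (((n : ℤ) • Pi.single (0 : Fin 4) (1 : ℤ)) + Pi.single c 1))
      - latticeGreen ((0 : Site 4) + Pi.single (Fin.succ a') 1 - ((n : ℤ) • Pi.single (0 : Fin 4) (1 : ℤ)))
      + latticeGreen ((0 : Site 4) + Pi.single (Fin.succ a') 1 - (((n : ℤ) • Pi.single (0 : Fin 4) (1 : ℤ)) + Pi.single c 1)))| ≤
      7 * (16 * 12 ^ 3 / (2 / (3 * π)) ^ 5) / (n : ℝ) ^ 5 / (2 * π) ^ 3 := by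
  induction c using Fin.cases with
  | zero =>
    rw [group_eq_s0, group_eq_s0, ← neg_sub, abs_neg, neg_sub_neg, show n + 1 + 1 = n + 2 from rfl]
    exact GreenDecay.abs_diff_00s_le a' hn (-Pi.single a' 1)
  | succ c' =>
    rw [group_eq_ss, group_eq_ss, ← neg_sub, abs_neg, neg_sub_neg]
    have h := GreenDecay.abs_diff_0ss_le a' c' hn (-Pi.single a' 1)
    refine h.trans ?_
    have h0 : 0 ≤ (16 * 12 ^ 3 / (2 / (3 * π)) ^ 5) / (n : ℝ) ^ 5 / (2 * π) ^ 3 := by positivity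
    calc 1 * (16 * 12 ^ 3 / (2 / (3 * π)) ^ 5) / (n : ℝ) ^ 5 / (2 * π) ^ 3
        = 1 * ((16 * 12 ^ 3 / (2 / (3 * π)) ^ 5) / (n : ℝ) ^ 5 / (2 * π) ^ 3) := by ring
      _ ≤ 7 * ((16 * 12 ^ 3 / (2 / (3 * π)) ^ 5) / (n : ℝ) ^ 5 / (2 * π) ^ 3) := mul_le_mul_of_nonneg_right (by norm_num) h0
      _ = 7 * (16 * 12 ^ 3 / (2 / (3 * π)) ^ 5) / (n : ℝ) ^ 5 / (2 * π) ^ 3 := by ring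

/-! ### Bounds for the kernel between a spatial plaquette at the origin and a plaquette at `m e₀` -/

/-- `|ite P t 0| ≤ B` from `|t| ≤ B`, `0 ≤ B`. -/
theorem abs_ite_le {P : Prop} [Decidable P] {t B : ℝ} (ht : |t| ≤ B) (hB : 0 ≤ B) : |(if P then t else 0)| ≤ B := by
  split_ifs
  · exact ht
  · simpa using hB

/-- **Decay of the spatial–arbitrary plaquette kernel**: for spatial planes `0 < i < j`, all `k < l` and `m ≥ 1`,
`|K((0;i,j),(m e₀;k,l))| ≤ 2·C₄/m⁴`, `C₄ = (π/2)(2·12³/(2/(3π))⁴)/(2π)³`. -/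
theorem abs_kernel_le (i j k l : Fin 4) (hi : 0 < i) (hij : i < j) (hkl : k < l) {m : ℕ} (hm : 1 ≤ m) :
    |curvatureTwoPoint (d := 4) (((0 : Site 4), ⟨(i, j), hij⟩) : ZdPlaquette 4)
        ((((m : ℤ) • Pi.single (0 : Fin 4) (1 : ℤ) : Site 4), ⟨(k, l), hkl⟩) : ZdPlaquette 4)| ≤
      2 * (π / 2 * (2 * 12 ^ 3 / (2 / (3 * π)) ^ 4) / (m : ℝ) ^ 4 / (2 * π) ^ 3) := by
  have hj : 0 < j := hi.trans hij
  obtain ⟨i', rfl⟩ := Fin.eq_succ_of_ne_zero (Fin.pos_iff_ne_zero.1 hi)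
  obtain ⟨j', rfl⟩ := Fin.eq_succ_of_ne_zero (Fin.pos_iff_ne_zero.1 hj)
  set B : ℝ := π / 2 * (2 * 12 ^ 3 / (2 / (3 * π)) ^ 4) / (m : ℝ) ^ 4 / (2 * π) ^ 3 with hB
  have hB0 : 0 ≤ B := by positivity
  rw [curvatureTwoPoint_eq_groups]
  have T1 := abs_group_le j' l hm
  have T2 := abs_group_le j' k hm
  have T3 := abs_group_le i' l hm
  have T4 := abs_group_le i' k hm
  rw [← hB] at T1 T2 T3 T4
  have A1 := abs_ite_le (P := Fin.succ i' = k) T1 hB0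
  have A2 := abs_ite_le (P := Fin.succ i' = l) T2 hB0
  have A3 := abs_ite_le (P := Fin.succ j' = k) T3 hB0
  have A4 := abs_ite_le (P := Fin.succ j' = l) T4 hB0
  rw [abs_div, abs_two]
  rw [div_le_iff₀ (by norm_num : (0:ℝ) < 2)]
  have := abs_add_le _ _ |>.trans (add_le_add (abs_sub _ _ |>.trans (add_le_add (abs_sub _ _ |>.trans (add_le_add A1 A2)) A3)) A4)
  linarith

/-- **Decay of the `m`-difference of the kernel**: for spatial planes `0 < i < j`, all `k < l` and `n ≥ 1`,
`|K((0;i,j),((n+1) e₀;k,l)) − K((0;i,j),(n e₀;k,l))| ≤ 2·C₅/n⁵`, `C₅ = 7(16·12³/(2/(3π))⁵)/(2π)³`. -/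
theorem abs_kernel_succ_sub_le (i j k l : Fin 4) (hi : 0 < i) (hij : i < j) (hkl : k < l) {n : ℕ} (hn : 1 ≤ n) :
    |curvatureTwoPoint (d := 4) (((0 : Site 4), ⟨(i, j), hij⟩) : ZdPlaquette 4)
        (((((n + 1 : ℕ) : ℤ) • Pi.single (0 : Fin 4) (1 : ℤ) : Site 4), ⟨(k, l), hkl⟩) : ZdPlaquette 4) -
      curvatureTwoPoint (d := 4) (((0 : Site 4), ⟨(i, j), hij⟩) : ZdPlaquette 4)
        ((((n : ℤ) • Pi.single (0 : Fin 4) (1 : ℤ) : Site 4), ⟨(k, l), hkl⟩) : ZdPlaquette 4)| ≤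
      2 * (7 * (16 * 12 ^ 3 / (2 / (3 * π)) ^ 5) / (n : ℝ) ^ 5 / (2 * π) ^ 3) := by
  have hj : 0 < j := hi.trans hij
  obtain ⟨i', rfl⟩ := Fin.eq_succ_of_ne_zero (Fin.pos_iff_ne_zero.1 hi)
  obtain ⟨j', rfl⟩ := Fin.eq_succ_of_ne_zero (Fin.pos_iff_ne_zero.1 hj)
  set B : ℝ := 7 * (16 * 12 ^ 3 / (2 / (3 * π)) ^ 5) / (n : ℝ) ^ 5 / (2 * π) ^ 3 with hB
  have hB0 : 0 ≤ B := by positivity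
  rw [curvatureTwoPoint_eq_groups, curvatureTwoPoint_eq_groups]
  have T1 := abs_group_diff_le j' l hn
  have T2 := abs_group_diff_le j' k hn
  have T3 := abs_group_diff_le i' l hn
  have T4 := abs_group_diff_le i' k hn
  rw [← hB] at T1 T2 T3 T4
  -- differences of guarded groups
  have D : ∀ (P : Prop) [Decidable P] (s t : ℝ), |s - t| ≤ B →
      |(if P then s else 0) - (if P then t else 0)| ≤ B := by
    intro P _ s t h
    split_ifs
    · exact h
    · simpa using hB0
  have A1 := D (Fin.succ i' = k) _ _ T1
  have A2 := D (Fin.succ i' = l) _ _ T2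
  have A3 := D (Fin.succ j' = k) _ _ T3
  have A4 := D (Fin.succ j' = l) _ _ T4
  rw [← sub_div, abs_div, abs_two, div_le_iff₀ (by norm_num : (0:ℝ) < 2)]
  -- regroup the difference of the two four-term sums
  have e : ∀ (g1 g2 g3 g4 f1 f2 f3 f4 : ℝ), (g1 - g2 - g3 + g4) - (f1 - f2 - f3 + f4) =
      (g1 - f1) - (g2 - f2) - (g3 - f3) + (g4 - f4) := fun _ _ _ _ _ _ _ _ => by ring
  rw [e]
  have := abs_add_le _ _ |>.trans (add_le_add (abs_sub _ _ |>.trans (add_le_add (abs_sub _ _ |>.trans (add_le_add A1 A2)) A3)) A4)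
  linarith

end KernelDecay

end Summit.QuantumFields.YangMills.Theorems.HankelDensitySplitting.LogWindow

end
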